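import Summits.AtomisticToContinuum.BoseEinsteinCondensation.Theses.BECCutLineWeakDisorder
import Summits.AtomisticToContinuum.BoseEinsteinCondensation.Theses.BECClassicalWindow
import Summits.AtomisticToContinuum.BoseEinsteinCondensation.Theses.BECNudgeWalk
import Summits.AtomisticToContinuum.BoseEinsteinCondensation.Theorems.BECCutLineWeakDisorderGroundStateRigidityHardCoreOfConnected
import Summits.AtomisticToContinuum.BoseEinsteinCondensation.Theorems.BECCutLineWeakDisorderGroundStateRigidityStubPosOfConnected
import Summits.AtomisticToContinuum.BoseEinsteinCondensation.Theorems.BECCutLineWeakDisorderGroundStateRigidityReduction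
import Summits.AtomisticToContinuum.BoseEinsteinCondensation.Theorems.BECCutLineWeakDisorderGroundStateRigidityLocBdd
import Summits.AtomisticToContinuum.BoseEinsteinCondensation.Theorems.GroundStateRigidity.Negative.LoadBearingHypotheses
import Literature.MathematicalPhysics.QuantumManyBody.BoseGasDirichletMonotonicity
import Mathlib.Topology.Connected.LocallyPathConnected
import Mathlib.Topology.Algebra.Module.LocallyConvex
import HarnessLib.Audit

/-!
# Line `PermanentMember` — an ALTERNATIVE skeleton for crux `BECCutLineWeakDisorder.GroundStateRigidity`
(item stmt-AtomisticToContinuum-9072, shared by 8 routes; strategist seat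
planner-cstrat-stmt-AtomisticToContinuum-9072-s1-0, 2026-08-17; registered ALONGSIDE the live line `Sketch`
of lead prover-line-stmt-AtomisticToContinuum-9072-c4-0 — it does not touch that skeleton or its stubs)

Crux (fixed, by name): `GroundStateRigidity` — for every repulsive finite-range `v` there is `ρ₀ > 0` such that
for `0 < ρ < ρ₀`, all large `N` and every `η > 0` some `δ > 0` makes any two `δ`-near-minimisers of the Dirichlet
energy in the box of side `(N/ρ)^{1/3}` `η`-close in `L²` up to a constant phase.

## What the live line leaves open, and what this line replaces it by

Line `Sketch` (skeleton v8) has landed everything except two research kernels: Stub 21 `stub_cubeConnected`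
(the labelled hard-sphere configuration space `F_b(N,L) = {X ∈ Λ_L^N : |xᵢ−xⱼ| > b}` is PATH-CONNECTED once
`N b³ ≤ c₀ L³` — Baryshnikov–Bubenik–Kahle's open question, IMRN 2014 §6) and Stub 22 (the "zoo" of walls that are
not a plain hard core). Connectivity is far more than the crux needs: uniqueness of the Bose ground state for hard
cores is equivalent to "the ENERGY-MINIMISING components of `F_b` form one `S_N`-orbit". This line prices every
component that has a PERMANENT MEMBER — a label `i` which, at EVERY configuration of the component, has some other
particle within distance `2b` — out of the ground state, by comparing two elementary quantities:

* the one-particle CONFINEMENT COST `c/b²` of a permanent member (a ray-wise Poincaré inequality in the contact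
  shell `b < |xᵢ − xⱼ| ≤ 2b`, where the state vanishes on the inner sphere; Stub A), kept for a FIXED label with no
  localisation error because the remaining `N` particles are extracted fibrewise by the tree's Dirichlet group
  extraction `groundStateEnergy_mul_le_setLIntegral_group` (which needs symmetry only under the permutations
  fixing `i`), and
* the bosonic INSERTION COST `μ = A/ℓ²`, `ℓ ≍ ρ^{-1/3}`: `E₀(N+1, L) ≤ E₀(N, L) + A/ℓ²` (Stub B) — proved in the
  BOSE frame with NO exchange terms: the extra particle is the unique particle in a reserved grid cube `Q` whose
  `3ℓ`-neighbourhood is otherwise empty (so the `N+1` symmetrised terms have pairwise disjoint supports), the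
  `N`-particle near-minimiser is cut by the IMS pair `cos Θ · Φ`, `sin Θ · Φ` of ONE smooth occupation angle `Θ`
  (pointwise identity `|∇(cos Θ Φ)|² + |∇(sin Θ Φ)|² = |∇Φ|² + |∇Θ|²|Φ|²`, no integration by parts), the
  complementary piece is fed back into the variational principle, and the cube is chosen among the `≍ L³/ℓ³ ≫ N`
  grid cubes by averaging (pigeonhole on two finite sums).

At low density `μ < c/b²`, so (Stub C, "sector exclusion": a closed-form limit argument plus `C¹` splitting along
unions of components and an `m`-counting symmetrisation over the never-lonely labels) every Bose ground state
VANISHES on the union `U'` of the components of `F_b ∩ Λ^N` that have a permanent member. The complementary union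
`S` (components in which every label is somewhere `2b`-lonely) is `S_N`-invariant and open; the landed
component-wise Perron–Frobenius machinery of line `Sketch` (Stubs 14, 16–20: `stub_vanishOffFree`,
`stub_posOfConnected`, `stub_uniqueOfPosOn`, energy truncation `groundStateEnergy_trunc_iSup_hardCore`) then gives
uniqueness as soon as `S` is chain-connected. THAT is the new geometric kernel, split into a provable parking lemma
(Stub D: all `2b`-separated configurations are joined in `F_b`, `N b³ ≤ c₁ L³`) and the OPEN residue (Stub E,
"Theseus": a component in which every label is somewhere `2b`-lonely contains a configuration in which all labels
are `2b`-lonely at once). `CubeConnected ⇒ (D ∧ E)`, not conversely: a dilute container-jammed backbone (vault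
foam, notched shell — the lead's KERNEL-c4 §2 candidates) REFUTES `CubeConnected` but is harmless here, because a
jammed backbone keeps its members within `2b` of their contacts at every configuration of its (tight) component.
What would kill Stub E is only a "ship-of-Theseus" trap: a non-principal component that can shed EVERY label to
distance `> 2b` somewhere while never dissolving. The zoo (Stub F) is carried verbatim from `Sketch` Stub 22
(shared open kernel; this line does not bear on it).

Mechanism credit: crux idea cards `kinetic-smallness-unjamming` (ideator 1: removal–kinetic inequality, PERSISTENCE
kernel (5)), `tight-label-split` (ideator 2: uniformly tight label, (UT)) and the lead's announced contingency
(KERNEL-c4 §3: (TT)+(INS)+(FLOOR)+Bose=abs) — none of which was ever planned into a checked skeleton. Deltas of this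
skeleton: insertion bound in the Bose frame by disjoint supports (no `Bose = Boltzmann`, no Jastrow factor, no
hole-averaged normalisation under the integral); confinement read at the contact scale `2b` by rays (no crushed-ice
capacity estimate, no cell inradius), so that the comparison is `c/b²` against `A ρ^{2/3}` with absolute `c, A`;
Stab(`i`)-symmetric fibres via the landed group extraction (no RMS symmetrisation).

## Disproof used (Cruxes/GroundStateRigidity/Disproof.lean; Theorems/GroundStateRigidity/Negative/*)

`groundStateRigidity_false_without_finiteRange` (v ≡ ⊤): the line USES finite range — Stub B inserts the extra
particle beyond the range `R` of `v`. `groundStateRigidity_false_at_all_densities` (hard spheres at `ρ = 64`) and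
`Negative/TwoHardSpheres` (degenerate two-sphere boxes): the line USES low density three times — `E₀ < ⊤`
eventually (`stub_finiteEnergyLowDensity`), `μ(ρ) = A/ℓ² < c/b²` with `1000 ρ ℓ³ ≤ 1`, and `N b³ ≤ min(c₁,c₂) L³` in
Stubs D/E. No stub is an instance of a landed Negative lemma (D/E at `N = 2` force `L ≥ (2/c)^{1/3} b ≫ b`, where
`F_b(2, L)` is connected).

## Stubs (6; `sorry` only inside `stub_*`)

* A `stub_neighbourPoincare` (M, provable): ray-wise Poincaré in the contact shell, absolute constant.
* B `stub_insertionDisjoint` (L, provable): Bose-frame insertion bound `E₀(n+1,L) ≤ E₀(n,L) + A/ℓ²` at `1000 n ℓ³ ≤ L³`,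
  `ℓ > R`.
* C `stub_sectorExclusion` (L, provable): given A at constant `c` and the gap `E₀(N+1) + g ≤ E₀(N) + c/b²`, every
  ground state vanishes a.e. on the union of components with a permanent member.
* D `stub_parkingTwoB` (L, provable geometry): `2b`-separated configurations are joined in `F_b`, `N b³ ≤ c₁ L³`.
* E `stub_theseus` (OPEN geometry, the kernel; strictly weaker than `CubeConnected`).
* F `stub_uniquenessKernelZoo` (OPEN, = `Sketch` Stub 22 verbatim).

Composition (sorry-free): `hasUniqueGroundState_hardCore_of_sectorOrdering` (the local statement at `(v, N+1, L)`),
`uniqueHardCore` (the essential hard-core class, eventually at low density), `uniquenessKernel`,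
`GroundStateRigidity_of` (via the landed `groundStateRigidity_of_uniquenessKernel` and
`hasUniqueGroundState_of_essLocBdd`).
-/

noncomputable section

open MeasureTheory Filter Metric
open scoped ENNReal NNReal Topology

namespace Summit.AtomisticToContinuum.BoseEinsteinCondensation.Cruxes.GroundStateRigidity.PermanentMember

open Literature.MathematicalPhysics.QuantumManyBody.BoseGas
open Summit.AtomisticToContinuum.BoseEinsteinCondensation.Theorems.GroundStateRigidity

/-! ## Stubs -/

/-- **Stub A — neighbour Poincaré inequality in the contact shell (absolute constant).** There is an
absolute `c > 0` such that for every `N`, `b > 0`, label `i` and `C¹` function `φ` on `(ℝ³)^N` vanishing wherever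
some pair of particles is at distance `≤ b` (hard cores of diameter `b`), the kinetic energy of particle `i` controls
the mass of `φ` on the region where particle `i` has a neighbour within `2b`:
`(c/b²) ∫_{∃ j ≠ i, |xᵢ−xⱼ| ≤ 2b} |φ|² ≤ ∫ |∇ᵢ φ|²`. Proof sketch: freeze the other particles; for each `j ≠ i`
integrate in polar coordinates around `xⱼ` over the shell `b < |y − xⱼ| ≤ 2b`; along each ray `φ(xⱼ + bω) = 0`,
so `∫_b^{2b} |f|² r² dr ≤ 2b² · 4 ∫_b^{2b} |∂_r f|² r²/b² dr` (one-sided Poincaré on an interval of length `b`,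
weights `r² ∈ [b², 4b²]`); the shells around the (pairwise `> b`-separated, where `φ ≠ 0`) centres `xⱼ` overlap at
most `5³` at a time, so summing over `j` loses only an absolute factor (`c = 1/250` works). [folklore] -/
theorem stub_neighbourPoincare :
    ∃ c : ℝ, 0 < c ∧ ∀ (N : ℕ) (b : ℝ) (i : Fin N) (φ : Config N → ℂ), 0 < b → ContDiff ℝ 1 φ →
      (∀ X : Config N, (∃ j j' : Fin N, j ≠ j' ∧ dist (X j) (X j') ≤ b) → φ X = 0) →
      ENNReal.ofReal (c / b ^ 2) *
          ∫⁻ X, {Y : Config N | ∃ j : Fin N, j ≠ i ∧ dist (Y i) (Y j) ≤ 2 * b}.indicator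
            (fun Y => (‖φ Y‖₊ : ℝ≥0∞) ^ 2) X ≤
        ∫⁻ X, ∑ k : Fin 3,
          (‖fderiv ℝ φ X (Pi.single i (EuclideanSpace.single k (1 : ℝ)))‖₊ : ℝ≥0∞) ^ 2 := by
  sorry

/-- **Stub B — bosonic insertion bound (chemical-potential window) by disjoint supports.** There is an
absolute `A > 0` such that for `n ≥ 1` bosons in the Dirichlet box `Λ_L`, a measurable repulsive pair profile `v` of
range `R` (`v = 0` beyond `R`; `⊤` allowed below), and a length `ℓ > R` with `1000 n ℓ³ ≤ L³`:
`E₀(n+1, L) ≤ E₀(n, L) + A/ℓ²`. Proof sketch: grid of `M = ⌊L/ℓ⌋ ≥ 10` cubes `Q_m` of side `ℓ' ∈ [ℓ, 2ℓ)`; for a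
`δ`-near-minimiser `Φ` of the `n`-problem and a cube `Q_m`, the smooth occupation angle
`Θ_m(X̂) = (π/2)(1 − ∏ₖ (1 − u_m(x̂ₖ)))` (`u_m = 1` on the `3ℓ'`-cube, `0` off the `5ℓ'`-cube, `|∇u_m| ≤ A₁/ℓ`)
gives the IMS pair `cos Θ_m · Φ`, `sin Θ_m · Φ` with the POINTWISE identity
`|∇(cos Θ Φ)|² + |∇(sin Θ Φ)|² = |∇Φ|² + |∇Θ|²|Φ|²` and `|∇Θ_m|² ≤ (A₂/ℓ²)·#{k : x̂ₖ ∈ 5ℓ'-cube}`; feeding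
`sin Θ_m Φ` (symmetric, `C¹`, Dirichlet) back into the variational principle,
`q(cos Θ_m Φ)/‖cos Θ_m Φ‖² ≤ E₀(n) + (δ + (A₂/ℓ²) p_m)/(1 − p_m)` with `p_m = ∫ #{k : x̂ₖ ∈ 5ℓ'-cube of m}|Φ|²`,
and `∑_m p_m ≤ 125 n` picks a cube with `p_m ≤ 1/4`. The `(n+1)`-particle trial state
`Ψ(X) = ∑ᵢ (cos Θ_m Φ)(X̂ᵢ) f(xᵢ)` (`f` a `C¹` bump in `Q_m`, `X̂ᵢ` = `X` without particle `i`) is Bose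
symmetric, its `n+1` terms have pairwise DISJOINT supports (term `i ≠ 0` forces `xᵢ ∈ Q_m` and every other
particle outside the `3ℓ'`-cube), the extra particle is farther than `ℓ > R` from all others (no interaction, hard
core respected), so `energy Ψ = q(cos Θ_m Φ)/‖cos Θ_m Φ‖² + ∫|∇f|²/∫|f|² ≤ E₀(n) + O(δ) + A/ℓ²`; `δ ↓ 0`.
[cite: CyconEtAl1987, Thm 3.2; LSSY2005, (2.52)–(2.53)] -/
theorem stub_insertionDisjoint :
    ∃ A : ℝ, 0 < A ∧ ∀ (n : ℕ) (L R ℓ : ℝ) (v : ℝ → ℝ≥0∞), 1 ≤ n → 0 < L → Measurable v →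
      0 ≤ R → R < ℓ → (∀ r : ℝ, R < r → v r = 0) → 1000 * (n : ℝ) * ℓ ^ 3 ≤ L ^ 3 →
      groundStateEnergy v (n + 1) L ≤ groundStateEnergy v n L + ENNReal.ofReal (A / ℓ ^ 2) := by
  sorry

/-- **Stub C — sector exclusion: components with a permanent member carry no ground-state mass once the
confinement cost beats the insertion cost.** Hard-core class (`v = ⊤` on `[0, b]`, measurable), `N + 1` bosons in
`Λ_L`. GIVEN the neighbour Poincaré inequality of Stub A at some constant `c > 0` (as a hypothesis) and the GAP
`E₀(N+1, L) + g ≤ E₀(N, L) + c/b²` for some `g > 0`, every closed-form ground state vanishes a.e. on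
`U' = {X ∈ F : some label i has, at EVERY configuration of the component of X in F, a neighbour within 2b}`,
`F = {all pairs > b} ∩ Λ^{N+1}`. Proof sketch: `U'` and `S = F ∖ U'` are `S_{N+1}`-invariant unions of components
of the open set `F` (the defining property is constant along components), hence open; a finite-energy trial state
`Φ` vanishes with its derivative on `K = {some pair ≤ b}` and off the open box, so `Φ·1_S`, `Φ·1_{U'}` and, for each
label `i` and multiplicity `m`, `Φ·1_{V_m ∩ W_i}` (`W_i` = components on which `i` is never lonely, `V_m` = those
with exactly `m` such labels) are `C¹`, and the energy splits additively. On `W_i`: particle `i`'s kinetic energy is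
`≥ (c/b²)·mass` (hypothesis; `W_i ⊆ {∃ j ≠ i, |xᵢ−xⱼ| ≤ 2b}`), the other `N` particles' kinetic energy plus their
mutual interaction is `≥ E₀(N, L)·mass` fibrewise (`groundStateEnergy_mul_le_setLIntegral_group` with the group
`Fin.succAbove i`, symmetry under the permutations fixing `i`, which preserve `V_m ∩ W_i`); summing over `i` counts
each point of `V_m` exactly `m` times, so `q(Φ1_{U'}) ≥ (E₀(N) + c/b²)‖Φ1_{U'}‖² ≥ (E₀(N+1) + g)‖Φ1_{U'}‖²`, while
`q(Φ1_S) ≥ E₀(N+1)‖Φ1_S‖²` (`groundStateEnergy_mul_normSq_le`). For a ground state `Ψ` and trial states `Φₙ → Ψ`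
in `L²` with `liminf energy ≤ E₀(N+1) + ε` this gives `limsup ‖Φₙ1_{U'}‖² ≤ ε/g`, so `∫_{U'}|Ψ|² = 0`.
[cite: ReedSimonIV1978, §XIII.12 Thm XIII.46; LSSY2005, (2.52)–(2.53)] -/
theorem stub_sectorExclusion :
    ∀ (N : ℕ) (v : ℝ → ℝ≥0∞) (L b c : ℝ) (g : ℝ≥0∞), 0 < L → 0 < b → 0 < c → 0 < g → Measurable v →
      (∀ s : ℝ, s ∈ Set.Icc 0 b → v s = ⊤) →
      (∀ (i : Fin (N + 1)) (φ : Config (N + 1) → ℂ), ContDiff ℝ 1 φ →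
        (∀ X : Config (N + 1), (∃ j j' : Fin (N + 1), j ≠ j' ∧ dist (X j) (X j') ≤ b) → φ X = 0) →
        ENNReal.ofReal (c / b ^ 2) *
            ∫⁻ X, {Y : Config (N + 1) | ∃ j : Fin (N + 1), j ≠ i ∧ dist (Y i) (Y j) ≤ 2 * b}.indicator
              (fun Y => (‖φ Y‖₊ : ℝ≥0∞) ^ 2) X ≤
          ∫⁻ X, ∑ k : Fin 3,
            (‖fderiv ℝ φ X (Pi.single i (EuclideanSpace.single k (1 : ℝ)))‖₊ : ℝ≥0∞) ^ 2) →
      groundStateEnergy v (N + 1) L + g ≤ groundStateEnergy v N L + ENNReal.ofReal (c / b ^ 2) →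
      ∀ Ψ : Config (N + 1) → ℂ, IsGroundState v L Ψ →
        ∀ᵐ X : Config (N + 1),
          X ∈ {X : Config (N + 1) |
              X ∈ {Z : Config (N + 1) | Z ∈ boxN (N + 1) L ∧
                    ∀ i j : Fin (N + 1), i ≠ j → b < dist (Z i) (Z j)} ∧
              ∃ i : Fin (N + 1), ∀ Y ∈ connectedComponentIn
                  {Z : Config (N + 1) | Z ∈ boxN (N + 1) L ∧
                    ∀ i j : Fin (N + 1), i ≠ j → b < dist (Z i) (Z j)} X,
                ∃ j : Fin (N + 1), j ≠ i ∧ dist (Y i) (Y j) ≤ 2 * b} →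
            Ψ X = 0 := by
  sorry

/-- **Stub D — parking lemma (provable geometry): dilute well-separated configurations are joined.**
There is an absolute `c₁ > 0` such that for `N b³ ≤ c₁ L³` any two configurations of the free region
`F_b(N, L) = {X ∈ Λ_L^N : |xᵢ − xⱼ| > b ∀ i ≠ j}` all of whose pair distances exceed `2b` are joined by a continuous
path in `F_b(N, L)` (with labels). Proof sketch (Hilbert hotel): move the particles one at a time — first those near
a reserved corner region, out to free spots (volume count), then everybody in lattice order into a cubic parking
lattice of spacing `3b` in that corner, and run the same moves backwards for the target configuration; a single
particle moving among obstacles that are closed `b`-balls around centres pairwise `≥ 2b` apart and `≥ 2b` from its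
start and goal has a free straight-or-detour path (the balls are disjoint; corner pockets sealed by one ball need a
centre within `1.3 b`, excluded), and every intermediate configuration stays in `F_b`.
[cite: BaryshnikovBubenikKahle2014, §6; DiaconisLebeauMichel2010] -/
theorem stub_parkingTwoB :
    ∃ c₁ : ℝ, 0 < c₁ ∧ ∀ (N : ℕ) (L b : ℝ), 0 < b → (N : ℝ) * b ^ 3 ≤ c₁ * L ^ 3 →
      ∀ X ∈ {Z : Config N | Z ∈ boxN N L ∧ ∀ i j : Fin N, i ≠ j → b < dist (Z i) (Z j)},
      ∀ Y ∈ {Z : Config N | Z ∈ boxN N L ∧ ∀ i j : Fin N, i ≠ j → b < dist (Z i) (Z j)},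
        (∀ i j : Fin N, i ≠ j → 2 * b < dist (X i) (X j)) →
        (∀ i j : Fin N, i ≠ j → 2 * b < dist (Y i) (Y j)) →
        JoinedIn {Z : Config N | Z ∈ boxN N L ∧ ∀ i j : Fin N, i ≠ j → b < dist (Z i) (Z j)} X Y := by
  sorry

/-- **Stub E — OPEN KERNEL ("Theseus"; pure discrete geometry, strictly weaker than `CubeConnected`).**
There is an absolute `c₂ > 0` such that for `N b³ ≤ c₂ L³`: if, in the component of `X` in the free region
`F_b(N, L)`, EVERY label can be made `2b`-lonely somewhere (for each `i` some configuration of the component has all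
other particles farther than `2b` from particle `i`), then the component contains a configuration in which ALL labels
are `2b`-lonely at once (all pair distances `> 2b`). Contrapositively: a non-principal ("trapped") component has a
PERMANENT MEMBER. True for every trap certified by Connelly's struts principle (a container-jammed backbone keeps each
member within `2b` of its contacts throughout its tight component; KERNEL-c4 §1–2), vacuous if `F_b` is connected;
false only for a "ship-of-Theseus" trap that sheds every label while never dissolving — no mechanism known.
`CubeConnected` (Sketch Stub 21) implies it; the converse fails (vault foams).
[cite: BaryshnikovBubenikKahle2014, §6; Kahle2012; TorquatoStillinger2001; ConnellyWhiteley1996] -/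
theorem stub_theseus :
    ∃ c₂ : ℝ, 0 < c₂ ∧ ∀ (N : ℕ) (L b : ℝ), 0 < b → (N : ℝ) * b ^ 3 ≤ c₂ * L ^ 3 →
      ∀ X ∈ {Z : Config N | Z ∈ boxN N L ∧ ∀ i j : Fin N, i ≠ j → b < dist (Z i) (Z j)},
        (∀ i : Fin N, ∃ Y ∈ connectedComponentIn
            {Z : Config N | Z ∈ boxN N L ∧ ∀ i j : Fin N, i ≠ j → b < dist (Z i) (Z j)} X,
          ∀ j : Fin N, j ≠ i → 2 * b < dist (Y i) (Y j)) →
        ∃ Y ∈ connectedComponentIn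
            {Z : Config N | Z ∈ boxN N L ∧ ∀ i j : Fin N, i ≠ j → b < dist (Z i) (Z j)} X,
          ∀ i j : Fin N, i ≠ j → 2 * b < dist (Y i) (Y j) := by
  sorry

/-- **Stub F — OPEN KERNEL (the zoo; verbatim Stub 22 of line `Sketch`, shared): uniqueness at low density for
walls that are NOT a plain hard core with an essentially bounded tail** (hollow shells, hard cores with an
essentially unbounded finite shoulder, fat-Cantor walls, non-integrable finite walls). This line does not bear on it.
[cite: ReedSimonIV1978, Thm XIII.48] -/
theorem stub_uniquenessKernelZoo :
    ∀ v : ℝ → ℝ≥0∞, IsRepulsiveFiniteRange v →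
      (¬ ∀ r : ℝ, 0 < r → ∃ C : ℝ≥0, ∀ᵐ s : ℝ, r ≤ s → v s ≤ C) →
      (¬ ∃ b : ℝ, 0 < b ∧ ∃ C : ℝ≥0, (∀ᵐ s : ℝ, s ∈ Set.Icc 0 b → v s = ⊤) ∧
          (∀ᵐ s : ℝ, b < s → v s ≤ C)) →
      ∃ ρ₀ : ℝ, 0 < ρ₀ ∧ ∀ ρ : ℝ, 0 < ρ → ρ < ρ₀ → ∀ᶠ N : ℕ in atTop,
        ∀ Ψ Φ : Config N → ℂ, IsGroundState v (sideLength ρ N) Ψ →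
          IsGroundState v (sideLength ρ N) Φ →
          ∃ c : ℂ, ‖c‖ = 1 ∧ ∀ᵐ X : Config N, Φ X = c * Ψ X := by
  sorry

/-! ## Composition (sorry-free) -/

/-- The free region of exclusion distance `b` in the box (local abbreviation; the stubs state it inline). -/
abbrev free (N : ℕ) (L b : ℝ) : Set (Config N) :=
  {Z : Config N | Z ∈ boxN N L ∧ ∀ i j : Fin N, i ≠ j → b < dist (Z i) (Z j)}

/-- The union `U'` of the components of the free region that have a permanent member (a label with a neighbour
within `2b` at every configuration of the component). -/
abbrev crowded (N : ℕ) (L b : ℝ) : Set (Config N) :=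
  {X : Config N | X ∈ free N L b ∧ ∃ i : Fin N, ∀ Y ∈ connectedComponentIn (free N L b) X,
    ∃ j : Fin N, j ≠ i ∧ dist (Y i) (Y j) ≤ 2 * b}

/-- The union `S` of the components of the free region in which every label is somewhere `2b`-lonely (the carrier
of the ground states). -/
abbrev roomy (N : ℕ) (L b : ℝ) : Set (Config N) :=
  {X : Config N | X ∈ free N L b ∧ ∀ i : Fin N, ∃ Y ∈ connectedComponentIn (free N L b) X,
    ∀ j : Fin N, j ≠ i → 2 * b < dist (Y i) (Y j)}

/-- In an open subset of configuration space, a point of the connected component of `X` is joined to `X` by a path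
inside the set (components of open sets of a locally path-connected space are path-connected). [folklore] -/
theorem joinedIn_of_mem_connectedComponentIn {N : ℕ} {F : Set (Config N)} (hF : IsOpen F) {X Z : Config N}
    (hX : X ∈ F) (hZ : Z ∈ connectedComponentIn F X) : JoinedIn F X Z := by
  have hC : IsOpen (connectedComponentIn F X) := hF.connectedComponentIn
  have hconn : IsConnected (connectedComponentIn F X) := isConnected_connectedComponentIn_iff.2 hX
  have hpc : IsPathConnected (connectedComponentIn F X) := (hC.isConnected_iff_isPathConnected).1 hconn
  exact (hpc.joinedIn X (mem_connectedComponentIn hX) Z hZ).mono (connectedComponentIn_subset F X)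

/-- A point outside `roomy` is outside the free region or in `crowded` (pure logic). [folklore] -/
theorem mem_crowded_of_not_mem_roomy {N : ℕ} {L b : ℝ} {X : Config N} (hX : X ∉ roomy N L b)
    (hXf : X ∈ free N L b) : X ∈ crowded N L b := by
  refine ⟨hXf, ?_⟩
  by_contra h
  apply hX
  refine ⟨hXf, fun i => ?_⟩
  by_contra h'
  apply h
  refine ⟨i, fun Y hY => ?_⟩
  by_contra h''
  apply h'
  refine ⟨Y, hY, fun j hj => ?_⟩
  by_contra h3
  exact h'' ⟨j, hj, not_lt.1 h3⟩

/-- `roomy` is a union of components of the free region: the component of any of its points lies in it. [folklore] -/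
theorem connectedComponentIn_subset_roomy {N : ℕ} {L b : ℝ} {X : Config N} (hX : X ∈ roomy N L b) :
    connectedComponentIn (free N L b) X ⊆ roomy N L b := by
  intro Y hY
  refine ⟨connectedComponentIn_subset _ _ hY, fun i => ?_⟩
  obtain ⟨Z, hZ, hZi⟩ := hX.2 i
  refine ⟨Z, ?_, hZi⟩
  rwa [← connectedComponentIn_eq hY]

/-- `roomy` is open (components of the open free region are open). [folklore] -/
theorem isOpen_roomy (N : ℕ) (L b : ℝ) : IsOpen (roomy N L b) := by
  rw [isOpen_iff_mem_nhds]
  intro X hX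
  have hF : IsOpen (free N L b) := HardCoreOfConnected.isOpen_free N L b
  have hC : IsOpen (connectedComponentIn (free N L b) X) := hF.connectedComponentIn
  exact Filter.mem_of_superset (hC.mem_nhds (mem_connectedComponentIn hX.1))
    (connectedComponentIn_subset_roomy hX)

/-- **Uniqueness for the hard-core class from sector ordering (the local statement at `(v, N+1, L)`).**
For `v = ⊤` on `[0, b]`, `v ≤ C` beyond `b` (measurable), `L > 0`: IF the neighbour Poincaré inequality holds at
constant `c` (Stub A), the gap `E₀(N+1, L) + g ≤ E₀(N, L) + c/b²` holds for some `g > 0` (Stub B at low density),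
the conclusion of Stub C holds, and at `(N+1, L, b)` the parking and Theseus properties hold (Stubs D, E at
`(N+1) b³ ≤ min(c₁,c₂) L³`), then `E₀(N+1, L) < ⊤` implies `HasUniqueGroundState v (N+1) L`: ground states vanish
off the open `S_{N+1}`-invariant carrier `roomy` (Stub 14 of `Sketch` + Stub C), `roomy` is chain-connected
(Theseus + parking + `stub_polygonalChain`), so nonnegative ground states are a.e. positive on it
(`stub_posOfConnected` with `groundStateEnergy_trunc_iSup_hardCore`) and uniqueness follows (`stub_uniqueOfPosOn`).
[cite: ReedSimonIV1978, §XIII.12 Thms XIII.44–47] -/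
theorem hasUniqueGroundState_hardCore_of_sectorOrdering (N : ℕ) (v : ℝ → ℝ≥0∞) (L b : ℝ) (C : ℝ≥0)
    (hL : 0 < L) (hb : 0 < b) (hv : Measurable v) (hcore : ∀ s : ℝ, s ∈ Set.Icc 0 b → v s = ⊤)
    (htail : ∀ s : ℝ, b < s → v s ≤ C)
    (hexcl : ∀ Ψ : Config (N + 1) → ℂ, IsGroundState v L Ψ →
      ∀ᵐ X : Config (N + 1), X ∈ crowded (N + 1) L b → Ψ X = 0)
    (hpark : ∀ X ∈ free (N + 1) L b, ∀ Y ∈ free (N + 1) L b,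
      (∀ i j : Fin (N + 1), i ≠ j → 2 * b < dist (X i) (X j)) →
      (∀ i j : Fin (N + 1), i ≠ j → 2 * b < dist (Y i) (Y j)) → JoinedIn (free (N + 1) L b) X Y)
    (hthes : ∀ X ∈ free (N + 1) L b,
      (∀ i : Fin (N + 1), ∃ Y ∈ connectedComponentIn (free (N + 1) L b) X,
        ∀ j : Fin (N + 1), j ≠ i → 2 * b < dist (Y i) (Y j)) →
      ∃ Y ∈ connectedComponentIn (free (N + 1) L b) X, ∀ i j : Fin (N + 1), i ≠ j → 2 * b < dist (Y i) (Y j))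
    (hE : groundStateEnergy v (N + 1) L ≠ ⊤) : HasUniqueGroundState v (N + 1) L := by
  have hN1 : 1 ≤ N + 1 := Nat.succ_le_succ (Nat.zero_le N)
  have hF : IsOpen (free (N + 1) L b) := HardCoreOfConnected.isOpen_free (N + 1) L b
  set S : Set (Config (N + 1)) := roomy (N + 1) L b with hSdef
  have hSm : MeasurableSet S := (isOpen_roomy (N + 1) L b).measurableSet
  have hSsub : S ⊆ free (N + 1) L b := fun X hX => hX.1
  -- any two points of the carrier are joined inside the free region
  have hjoin : ∀ X ∈ S, ∀ Y ∈ S, JoinedIn (free (N + 1) L b) X Y := by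
    intro X hX Y hY
    obtain ⟨ZX, hZX, hZXl⟩ := hthes X hX.1 hX.2
    obtain ⟨ZY, hZY, hZYl⟩ := hthes Y hY.1 hY.2
    have h1 : JoinedIn (free (N + 1) L b) X ZX := joinedIn_of_mem_connectedComponentIn hF hX.1 hZX
    have h2 : JoinedIn (free (N + 1) L b) Y ZY := joinedIn_of_mem_connectedComponentIn hF hY.1 hZY
    have h3 : JoinedIn (free (N + 1) L b) ZX ZY :=
      hpark ZX (connectedComponentIn_subset _ _ hZX) ZY (connectedComponentIn_subset _ _ hZY) hZXl hZYl
    exact (h1.trans h3).trans h2.symm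
  have hchain : ∀ X ∈ S, ∀ Y ∈ S, ∃ (k : ℕ) (Z : ℕ → Config (N + 1)) (m : ℝ), Z 0 = X ∧ Z k = Y ∧ 0 < m ∧
      (∀ l : ℕ, l ≤ k → Z l ∈ boxN (N + 1) L) ∧
      ∀ l : ℕ, l < k → ∀ θ : ℝ, θ ∈ Set.Icc (0 : ℝ) 1 → ∀ i j : Fin (N + 1), i ≠ j →
        b + 2 * m ≤ ‖(1 - θ) • (Z l i - Z l j) + θ • (Z (l + 1) i - Z (l + 1) j)‖ :=
    fun X hX Y hY => stub_polygonalChain (N + 1) L b X Y (hjoin X hX Y hY)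
  -- ground states vanish off the carrier
  have hvan : ∀ Ψ : Config (N + 1) → ℂ, IsGroundState v L Ψ → ∀ᵐ X : Config (N + 1), X ∉ S → Ψ X = 0 := by
    intro Ψ hΨ
    filter_upwards [stub_vanishOffFree (N + 1) v L b hb hcore Ψ hΨ, hexcl Ψ hΨ] with X h1 h2 hX
    by_cases hXf : X ∈ free (N + 1) L b
    · exact h2 (mem_crowded_of_not_mem_roomy hX hXf)
    · exact h1 hXf
  refine stub_uniqueOfPosOn stub_lincombGroundState (N + 1) v L S hSm
    (stub_existsNonnegGroundState stub_compactness (N + 1) v L hE) hvan ?_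
  intro Ψ₀ hΨ₀ hGS
  exact stub_posOfConnected (stub_chainedTube stub_localTubeCore) (N + 1) v L b C hN1 hL hb hv hcore htail
    (groundStateEnergy_trunc_iSup_hardCore (N + 1) v L b C hN1 hL hb hv hcore htail) S hSm hSsub hchain
    hvan Ψ₀ hΨ₀ hGS

/-- Elementary bookkeeping for the insertion scale: with `ℓ = R + b √(A/c) + 1` one has `ℓ > R`, `ℓ > 0` and
`A/ℓ² < c/b²`. [folklore] -/
theorem insertionScale_bounds {A c b R : ℝ} (hA : 0 < A) (hc : 0 < c) (hb : 0 < b) (hR : 0 ≤ R) :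
    R < R + b * Real.sqrt (A / c) + 1 ∧ 0 < R + b * Real.sqrt (A / c) + 1 ∧
      A / (R + b * Real.sqrt (A / c) + 1) ^ 2 < c / b ^ 2 := by
  have hs : 0 ≤ Real.sqrt (A / c) := Real.sqrt_nonneg _
  have hbs : 0 ≤ b * Real.sqrt (A / c) := mul_nonneg hb.le hs
  refine ⟨by linarith, by linarith, ?_⟩
  set ℓ : ℝ := R + b * Real.sqrt (A / c) + 1 with hℓ
  have hℓpos : 0 < ℓ := by rw [hℓ]; linarith
  have hlt : b * Real.sqrt (A / c) < ℓ := by rw [hℓ]; linarith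
  -- `b² (A/c) < ℓ²`
  have hsq : b ^ 2 * (A / c) < ℓ ^ 2 := by
    have h1 : (b * Real.sqrt (A / c)) ^ 2 < ℓ ^ 2 := by
      exact pow_lt_pow_left₀ hlt hbs (by norm_num)
    rw [mul_pow, Real.sq_sqrt (div_nonneg hA.le hc.le)] at h1
    exact h1
  rw [div_lt_div_iff₀ (by positivity) (by positivity)]
  have : A * b ^ 2 = (b ^ 2 * (A / c)) * c := by field_simp
  rw [this]
  calc b ^ 2 * (A / c) * c < ℓ ^ 2 * c := by gcongr
    _ = c * ℓ ^ 2 := by ring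

/-- **Eventual uniqueness for the essential hard-core class at low density** — the part of the uniqueness kernel
this line is about (Stubs A–E; no `CubeConnected`): if `v = ⊤` a.e. on `[0, b]` and `v ≤ C` a.e. beyond `b`
(`b > 0`) for an admissible `v`, then for all `ρ` below an explicit `ρ₀(v) > 0` and all large `N` the ground state
in the box of side `(N/ρ)^{1/3}` is unique up to phase. Null sets of radii are invisible
(`hasUniqueGroundState_iff_offNull`); `ρ₀ = min (ρ₁(v), min(c₁,c₂)/b³, 1/(1000 ℓ³))` with the insertion scale
`ℓ = R + b√(A/c) + 1`, `R = max R₀ b` the range. [cite: ReedSimonIV1978, §XIII.12 Thm XIII.47] -/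
theorem uniqueHardCore (v : ℝ → ℝ≥0∞) (hv : IsRepulsiveFiniteRange v)
    (hHC : ∃ b : ℝ, 0 < b ∧ ∃ C : ℝ≥0, (∀ᵐ s : ℝ, s ∈ Set.Icc 0 b → v s = ⊤) ∧
      (∀ᵐ s : ℝ, b < s → v s ≤ C)) :
    ∃ ρ₀ : ℝ, 0 < ρ₀ ∧ ∀ ρ : ℝ, 0 < ρ → ρ < ρ₀ → ∀ᶠ N : ℕ in atTop,
      HasUniqueGroundState v N (sideLength ρ N) := by
  obtain ⟨b, hb, C, hcoreae, htailae⟩ := hHC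
  obtain ⟨R₀, hR₀⟩ := hv.2
  obtain ⟨cP, hcP, hPoinc⟩ := stub_neighbourPoincare
  obtain ⟨A, hA, hins⟩ := stub_insertionDisjoint
  obtain ⟨c₁, hc₁, hpark⟩ := stub_parkingTwoB
  obtain ⟨c₂, hc₂, hthes⟩ := stub_theseus
  obtain ⟨ρ₁, hρ₁, h₁⟩ := stub_finiteEnergyLowDensity v hv
  classical
  -- the range, enlarged so that it dominates `b`
  set R : ℝ := max R₀ b with hRdef
  have hR0 : 0 ≤ R := hb.le.trans (le_max_right _ _)
  have hvR : ∀ r : ℝ, R < r → v r = 0 := fun r hr => hR₀ r ((le_max_left _ _).trans_lt hr)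
  -- a pointwise representative off a null set of radii
  set v' : ℝ → ℝ≥0∞ := fun s => if s ∈ Set.Icc 0 b then ⊤ else (if b < s then min (v s) C else v s)
    with hv'def
  set Sbad : Set ℝ := {s | s ∈ Set.Icc 0 b ∧ v s ≠ ⊤} ∪ {s | b < s ∧ (C : ℝ≥0∞) < v s} with hSbad
  have hSm : MeasurableSet Sbad := by
    refine MeasurableSet.union ?_ ?_
    · exact measurableSet_Icc.inter (hv.1 (measurableSet_singleton ⊤)).compl
    · exact (measurableSet_lt measurable_const measurable_id).inter
        (measurableSet_lt measurable_const hv.1)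
  have hS0 : volume Sbad = 0 := by
    rw [hSbad, measure_union_null_iff]
    constructor
    · rw [measure_eq_zero_iff_ae_notMem]
      filter_upwards [hcoreae] with s hs
      simp only [not_and, not_not]
      exact hs
    · rw [measure_eq_zero_iff_ae_notMem]
      filter_upwards [htailae] with s hs
      simp only [not_and, not_lt]
      exact hs
  have hvv' : ∀ r, r ∉ Sbad → v r = v' r := by
    intro r hr
    simp only [hSbad, Set.mem_union, Set.mem_setOf_eq, not_or, not_and, not_not, not_lt] at hr
    by_cases h1 : r ∈ Set.Icc 0 b
    · simp only [hv'def]; rw [if_pos h1]; exact hr.1 h1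
    · by_cases h2 : b < r
      · simp only [hv'def]; rw [if_neg h1, if_pos h2]; exact (min_eq_left (hr.2 h2)).symm
      · simp only [hv'def]; rw [if_neg h1, if_neg h2]
  have hv'm : Measurable v' := by
    refine Measurable.ite measurableSet_Icc measurable_const ?_
    exact Measurable.ite (measurableSet_lt measurable_const measurable_id)
      (hv.1.min measurable_const) hv.1
  have hcore' : ∀ s : ℝ, s ∈ Set.Icc 0 b → v' s = ⊤ := fun s hs => by
    simp only [hv'def]; rw [if_pos hs]
  have htail' : ∀ s : ℝ, b < s → v' s ≤ C := by
    intro s hs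
    have hs' : s ∉ Set.Icc 0 b := fun h => not_lt.2 h.2 hs
    simp only [hv'def]; rw [if_neg hs', if_pos hs]; exact min_le_right _ _
  have hv'R : ∀ r : ℝ, R < r → v' r = 0 := by
    intro r hr
    have hbr : b < r := (le_max_right R₀ b).trans_lt hr
    have hr' : r ∉ Set.Icc 0 b := fun h => not_lt.2 h.2 hbr
    simp only [hv'def]; rw [if_neg hr', if_pos hbr, hvR r hr]; exact min_eq_left bot_le
  -- the insertion scale and the density threshold
  set ℓ : ℝ := R + b * Real.sqrt (A / cP) + 1 with hℓdef
  obtain ⟨hRℓ, hℓpos, hgapR⟩ := insertionScale_bounds hA hcP hb hR0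
  have hc12 : 0 < min c₁ c₂ := lt_min hc₁ hc₂
  set ρ₀ : ℝ := min ρ₁ (min (min c₁ c₂ / b ^ 3) (1 / (1000 * ℓ ^ 3))) with hρ₀def
  have hρ₀ : 0 < ρ₀ := lt_min hρ₁ (lt_min (by positivity) (by positivity))
  refine ⟨ρ₀, hρ₀, fun ρ hρ hρm => ?_⟩
  have hρ1 : ρ < ρ₁ := hρm.trans_le (min_le_left _ _)
  have hρc : ρ < min c₁ c₂ / b ^ 3 := hρm.trans_le ((min_le_right _ _).trans (min_le_left _ _))
  have hρℓ : ρ < 1 / (1000 * ℓ ^ 3) := hρm.trans_le ((min_le_right _ _).trans (min_le_right _ _))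
  filter_upwards [h₁ ρ hρ hρ1, eventually_ge_atTop 2] with N hE hN2
  obtain ⟨n, rfl⟩ : ∃ n, N = n + 1 := ⟨N - 1, by omega⟩
  have hn1 : 1 ≤ n := by omega
  have hN1 : 1 ≤ n + 1 := by omega
  set L : ℝ := sideLength ρ (n + 1) with hLdef
  have hL : 0 < L := by
    rw [hLdef]; unfold sideLength
    exact Real.rpow_pos_of_pos (div_pos (by exact_mod_cast hN1) hρ) _
  have hL3 : L ^ 3 = ((n + 1 : ℕ) : ℝ) / ρ := by
    rw [hLdef, Negative.sideLength_pow_three hρ (by omega)]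
  -- finite energy for the representative
  have hE' : groundStateEnergy v' (n + 1) L ≠ ⊤ := by
    rwa [← groundStateEnergy_congr_offNull hSm hS0 hvv' (n + 1) L]
  -- density: `(n+1) b³ ≤ c L³` for `c = c₁, c₂`
  have hdens : ∀ c : ℝ, min c₁ c₂ ≤ c → ((n + 1 : ℕ) : ℝ) * b ^ 3 ≤ c * L ^ 3 := by
    intro c hc
    rw [hL3]
    have hb3 : 0 < b ^ 3 := by positivity
    have h1 : ρ * b ^ 3 ≤ c := by
      have := (lt_div_iff₀ hb3).1 hρc
      exact this.le.trans hc
    have hNn : (0 : ℝ) ≤ ((n + 1 : ℕ) : ℝ) := by positivity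
    calc ((n + 1 : ℕ) : ℝ) * b ^ 3 = (((n + 1 : ℕ) : ℝ) / ρ) * (ρ * b ^ 3) := by field_simp
      _ ≤ (((n + 1 : ℕ) : ℝ) / ρ) * c := by gcongr
      _ = c * (((n + 1 : ℕ) : ℝ) / ρ) := by ring
  -- dilution for the insertion bound: `1000 n ℓ³ ≤ L³`
  have hdil : 1000 * (n : ℝ) * ℓ ^ 3 ≤ L ^ 3 := by
    rw [hL3]
    have hℓ3 : 0 < 1000 * ℓ ^ 3 := by positivity
    have h1 : ρ * (1000 * ℓ ^ 3) < 1 := by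
      have := (lt_div_iff₀ hℓ3).1 hρℓ
      linarith
    have hn : (n : ℝ) ≤ ((n + 1 : ℕ) : ℝ) := by exact_mod_cast Nat.le_succ n
    have hn0 : (0 : ℝ) ≤ n := by positivity
    rw [le_div_iff₀ hρ]
    calc 1000 * (n : ℝ) * ℓ ^ 3 * ρ = (n : ℝ) * (ρ * (1000 * ℓ ^ 3)) := by ring
      _ ≤ (n : ℝ) * 1 := by gcongr
      _ ≤ ((n + 1 : ℕ) : ℝ) := by rw [mul_one]; exact hn
  -- the gap: insertion cost `A/ℓ²` strictly below the confinement cost `cP/b²`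
  have hins' : groundStateEnergy v' (n + 1) L ≤ groundStateEnergy v' n L + ENNReal.ofReal (A / ℓ ^ 2) :=
    hins n L R ℓ v' hn1 hL hv'm hR0 hRℓ hv'R hdil
  set g : ℝ≥0∞ := ENNReal.ofReal (cP / b ^ 2) - ENNReal.ofReal (A / ℓ ^ 2) with hgdef
  have hμlt : ENNReal.ofReal (A / ℓ ^ 2) < ENNReal.ofReal (cP / b ^ 2) :=
    (ENNReal.ofReal_lt_ofReal_iff (by positivity)).2 hgapR
  have hg : 0 < g := tsub_pos_of_lt hμlt
  have hgap : groundStateEnergy v' (n + 1) L + g ≤ groundStateEnergy v' n L + ENNReal.ofReal (cP / b ^ 2) := by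
    calc groundStateEnergy v' (n + 1) L + g
        ≤ groundStateEnergy v' n L + ENNReal.ofReal (A / ℓ ^ 2) + g := add_le_add hins' le_rfl
      _ = groundStateEnergy v' n L + (ENNReal.ofReal (A / ℓ ^ 2) + g) := add_assoc _ _ _
      _ = groundStateEnergy v' n L + ENNReal.ofReal (cP / b ^ 2) := by
          rw [hgdef, add_tsub_cancel_of_le hμlt.le]
  -- sector exclusion (Stub C fed with Stub A at constant `cP`)
  have hexcl : ∀ Ψ : Config (n + 1) → ℂ, IsGroundState v' L Ψ →
      ∀ᵐ X : Config (n + 1), X ∈ crowded (n + 1) L b → Ψ X = 0 :=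
    stub_sectorExclusion n v' L b cP g hL hb hcP hg hv'm hcore'
      (fun i φ hφ hvan => hPoinc (n + 1) b i φ hb hφ hvan) hgap
  have hU : HasUniqueGroundState v' (n + 1) L :=
    hasUniqueGroundState_hardCore_of_sectorOrdering n v' L b C hL hb hv'm hcore' htail' hexcl
      (fun X hX Y hY hXl hYl => hpark (n + 1) L b hb (hdens c₁ (min_le_left _ _)) X hX Y hY hXl hYl)
      (fun X hX hall => hthes (n + 1) L b hb (hdens c₂ (min_le_right _ _)) X hX hall) hE'
  exact (hasUniqueGroundState_iff_offNull hSm hS0 hvv').2 hU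

/-- **The uniqueness kernel for unbounded admissible potentials** (the hypothesis of the landed reduction
`groundStateRigidity_of_uniquenessKernel`): class (a) — essentially locally bounded on `(0, ∞)` — by the landed
`hasUniqueGroundState_of_essLocBdd`; class (b) — the essential hard-core class — by `uniqueHardCore` (this line);
class (c) — the zoo — by Stub F. [cite: ReedSimonIV1978, §XIII.12 Thms XIII.47–48] -/
theorem uniquenessKernel :
    ∀ v : ℝ → ℝ≥0∞, IsRepulsiveFiniteRange v → (¬ ∃ C : ℝ≥0, ∀ r, v r ≤ C) →
      ∃ ρ₀ : ℝ, 0 < ρ₀ ∧ ∀ ρ : ℝ, 0 < ρ → ρ < ρ₀ → ∀ᶠ N : ℕ in atTop,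
        ∀ Ψ Φ : Config N → ℂ, IsGroundState v (sideLength ρ N) Ψ →
          IsGroundState v (sideLength ρ N) Φ →
          ∃ c : ℂ, ‖c‖ = 1 ∧ ∀ᵐ X : Config N, Φ X = c * Ψ X := by
  intro v hv _hunb
  by_cases hlb : ∀ r : ℝ, 0 < r → ∃ C : ℝ≥0, ∀ᵐ s : ℝ, r ≤ s → v s ≤ C
  · -- class (a): essentially locally bounded on `(0, ∞)`
    obtain ⟨ρ₁, hρ₁, h₁⟩ := stub_finiteEnergyLowDensity v hv
    refine ⟨ρ₁, hρ₁, fun ρ hρ hρ₁' => ?_⟩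
    filter_upwards [h₁ ρ hρ hρ₁', eventually_ge_atTop 1] with N hE hN
    have hL : 0 < sideLength ρ N := by
      unfold sideLength
      exact Real.rpow_pos_of_pos (div_pos (by exact_mod_cast hN) hρ) _
    intro Ψ Φ hΨ hΦ
    exact (hasUniqueGroundState_of_essLocBdd N v (sideLength ρ N) hN hL hv.1 hlb hE).2 Ψ Φ hΨ hΦ
  · by_cases hHC : ∃ b : ℝ, 0 < b ∧ ∃ C : ℝ≥0, (∀ᵐ s : ℝ, s ∈ Set.Icc 0 b → v s = ⊤) ∧
        (∀ᵐ s : ℝ, b < s → v s ≤ C)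
    · -- class (b): the essential hard-core class
      obtain ⟨ρ₀, hρ₀, h⟩ := uniqueHardCore v hv hHC
      refine ⟨ρ₀, hρ₀, fun ρ hρ hρ₀' => ?_⟩
      filter_upwards [h ρ hρ hρ₀'] with N hU
      intro Ψ Φ hΨ hΦ
      exact hU.2 Ψ Φ hΨ hΦ
    · -- class (c): the zoo
      exact stub_uniquenessKernelZoo v hv hlb hHC

/-- **`GroundStateRigidity` from the six registered stubs** (kernel-checked glue, no `sorry` of its own): the
uniqueness kernel above fed into the landed reduction `groundStateRigidity_of_uniquenessKernel` (eventual
uniqueness, then rigidity of near-minimisers by `stub_rigidityOfUnique` with `stub_compactness`).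
[cite: ReedSimonIV1978, §XIII.12] -/
theorem GroundStateRigidity_of :
    Summit.AtomisticToContinuum.BoseEinsteinCondensation.Theses.BECCutLineWeakDisorder.GroundStateRigidity :=
  groundStateRigidity_of_uniquenessKernel uniquenessKernel

/-- The same composition read against the verbatim-shared decl of route `BECClassicalWindow` (syntactically
identical `def`). [cite: ReedSimonIV1978, §XIII.12] -/
theorem GroundStateRigidity_proof_classicalWindow :
    Summit.AtomisticToContinuum.BoseEinsteinCondensation.Theses.BECClassicalWindow.GroundStateRigidity :=
  GroundStateRigidity_of

/-- The same composition read against the verbatim-shared decl of route `BECNudgeWalk` (syntactically identical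
`def`). [cite: ReedSimonIV1978, §XIII.12] -/
theorem GroundStateRigidity_proof_nudgeWalk :
    Summit.AtomisticToContinuum.BoseEinsteinCondensation.Theses.BECNudgeWalk.GroundStateRigidity :=
  GroundStateRigidity_of

end Summit.AtomisticToContinuum.BoseEinsteinCondensation.Cruxes.GroundStateRigidity.PermanentMember

end
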